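import Mathlib
import HarnessLib
import Literature.Analysis.ValidatedNumerics.IntervalLogArctan
import Summits.KontsevichZagierPeriods.Zeta5Search.Denom.LineProfileShape

/-!
# Two-point tangent certificate for the P15 line profile (P15 kernel, brick E5-4b)

HONEST FRAMING: systematic search; no irrationality claim unless certified.  This file proves an
inequality about an explicit elementary function of one real variable; no statement about
`ζ(2)`, `ζ(5)` or any linear form is made here.

With `P15 = profile (26/5)` and `D15 = angle (26/5) − 2π` (`Denom/LineProfileShape.lean`), the
two-point lemma `LineProfileShape.twoPoint` reduces `sup_{η>0} P15 ≤ c` to three facts at two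
rational points.  Here they are certified at `η₁ = 1344/625 = 2.1504`, `η₂ = 10753/5000 = 2.1506`
by the tree's kernel interval engine `Literature.Analysis.ValidatedNumerics` (`MI.logPos`,
`MI.arctan`, `MI.pi`, `MI.logNat2` at binary scale `2^56`, `KL = 64` logarithm terms,
`KA = 40` arctangent terms): evaluators `legA`/`legG`/`sumA`/`sumG`/`constG` with soundness
lemmas `mem_*`, the Boolean test `certCheck` (`certCheck_eq : certCheck = true` by
`decide +kernel`) and its soundness `certCheck_sound`, giving

* `profile_le : η ≠ 0 → profile (26/5) η ≤ −29.1078708`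

(the true supremum is `−29.10787082…`, attained near `η = 2.15050`).  This is input (8.4) of the
half-line bound of `P15KERNEL.md` §8; nothing here is conjectural.
-/

noncomputable section

open Real Set

namespace Summit.KontsevichZagierPeriods.Zeta5Search.Denom.TwoTaleP15LineCertificate

open Summit.KontsevichZagierPeriods.Zeta5Search.Denom.LineProfile
open Summit.KontsevichZagierPeriods.Zeta5Search.Denom.LineProfileShape
open Literature.Analysis.ValidatedNumerics.NumericsMP

/-- The binary scale `2^56` of the evaluation (a literal). -/
def sc : ℕ := 72057594037927936

/-- `0 < sc`. -/
theorem sc_pos : 0 < sc := by norm_num [sc]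

/-- Number of series terms for the logarithms. -/
def KL : ℕ := 64

/-- Number of series terms for the arctangents and for `π`. -/
def KA : ℕ := 40

/-- Enclosure of the angle `arctan ((p/5)/η)`, given `E ∋ η` and `piI ∋ π`. -/
def legA (piI E : MI) (p : ℤ) : Option MI :=
  match MI.divPos sc (MI.ofFrac sc p 5) E with
  | some Q => MI.arctan sc KA piI Q
  | none => none

/-- Soundness of `legA`. -/
theorem mem_legA {η : ℝ} {piI E : MI} (hpi : MI.mem sc Real.pi piI) (hE : MI.mem sc η E)
    {p : ℤ} {A : MI} (h : legA piI E p = some A) :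
    MI.mem sc (Real.arctan ((p : ℝ) / 5 / η)) A := by
  unfold legA at h
  split at h
  · rename_i Q hQ
    have hW : MI.mem sc ((p : ℝ) / 5) (MI.ofFrac sc p 5) := by
      simpa using MI.mem_ofFrac sc p (by norm_num : 0 < 5)
    exact MI.mem_arctan sc_pos hpi h (MI.mem_divPos sc_pos hQ hW hE)
  · simp at h

/-- Enclosure of `gPrim η (p/5)`, given `E ∋ η` and `piI ∋ π`. -/
def legG (piI E : MI) (p : ℤ) : Option MI :=
  match MI.logPos sc KL (((MI.ofFrac sc p 5).sqr sc).add (E.sqr sc)), legA piI E p with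
  | some L, some A =>
    some (((((MI.ofFrac sc p 5).mul sc L).divNat 2).sub (MI.ofFrac sc p 5)).add (E.mul sc A))
  | _, _ => none

/-- Soundness of `legG`. -/
theorem mem_legG {η : ℝ} {piI E : MI} (hpi : MI.mem sc Real.pi piI) (hE : MI.mem sc η E)
    {p : ℤ} {G : MI} (h : legG piI E p = some G) :
    MI.mem sc (gPrim η ((p : ℝ) / 5)) G := by
  unfold legG at h
  split at h
  · rename_i L A hL hA
    simp only [Option.some.injEq] at h
    subst h
    have hW : MI.mem sc ((p : ℝ) / 5) (MI.ofFrac sc p 5) := by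
      simpa using MI.mem_ofFrac sc p (by norm_num : 0 < 5)
    have hsum := MI.mem_add (MI.mem_sqr sc_pos hW) (MI.mem_sqr sc_pos hE)
    have hlog := (MI.mem_logPos sc_pos hL hsum).2
    have hA' := mem_legA hpi hE hA
    have key := MI.mem_add (MI.mem_sub (MI.mem_divNat (MI.mem_mul sc_pos hW hlog)
      (by norm_num : 0 < 2)) hW) (MI.mem_mul sc_pos hE hA')
    have e : (p : ℝ) / 5 * Real.log (((p : ℝ) / 5) ^ 2 + η ^ 2) / ((2 : ℕ) : ℝ) - (p : ℝ) / 5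
        + η * Real.arctan ((p : ℝ) / 5 / η) = gPrim η ((p : ℝ) / 5) := by
      simp only [gPrim]
      push_cast
      ring
    rw [e] at key
    exact key
  · simp at h

/-- The eight legs `(p, sign)` of the P15 profile at `ξ = 26/5` (abscissae `p/5`). -/
def legs : List (ℤ × ℤ) :=
  [(36, 1), (29, 1), (26, 1), (19, 1), (16, 1), (9, 1), (101, -1), (46, 1)]

/-- Signed sum of the angle enclosures over a list of legs. -/
def sumA (piI E : MI) : List (ℤ × ℤ) → Option MI
  | [] => some ⟨0, 0⟩
  | (p, s) :: l =>
    match legA piI E p, sumA piI E l with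
    | some A, some T => some (T.add (A.mulInt s))
    | _, _ => none

/-- Signed sum of the `gPrim` enclosures over a list of legs. -/
def sumG (piI E : MI) : List (ℤ × ℤ) → Option MI
  | [] => some ⟨0, 0⟩
  | (p, s) :: l =>
    match legG piI E p, sumG piI E l with
    | some G, some T => some (T.add (G.mulInt s))
    | _, _ => none

/-- The real signed angle sum over a list of legs. -/
def realA (η : ℝ) : List (ℤ × ℤ) → ℝ
  | [] => 0
  | (p, s) :: l => realA η l + Real.arctan ((p : ℝ) / 5 / η) * s

/-- The real signed `gPrim` sum over a list of legs. -/
def realG (η : ℝ) : List (ℤ × ℤ) → ℝ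
  | [] => 0
  | (p, s) :: l => realG η l + gPrim η ((p : ℝ) / 5) * s

/-- `mem sc 0 ⟨0, 0⟩`. -/
theorem mem_zero : MI.mem sc (0 : ℝ) ⟨0, 0⟩ := by
  simp [MI.mem]

/-- Soundness of `sumA`. -/
theorem mem_sumA {η : ℝ} {piI E : MI} (hpi : MI.mem sc Real.pi piI) (hE : MI.mem sc η E) :
    ∀ (l : List (ℤ × ℤ)) {T : MI}, sumA piI E l = some T → MI.mem sc (realA η l) T
  | [], T, h => by
    simp only [sumA, Option.some.injEq] at h
    subst h
    exact mem_zero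
  | (p, s) :: l, T, h => by
    simp only [sumA] at h
    split at h
    · rename_i A T' hA hT'
      simp only [Option.some.injEq] at h
      subst h
      exact MI.mem_add (mem_sumA hpi hE l hT') (MI.mem_mulInt (mem_legA hpi hE hA) s)
    · simp at h

/-- Soundness of `sumG`. -/
theorem mem_sumG {η : ℝ} {piI E : MI} (hpi : MI.mem sc Real.pi piI) (hE : MI.mem sc η E) :
    ∀ (l : List (ℤ × ℤ)) {T : MI}, sumG piI E l = some T → MI.mem sc (realG η l) T
  | [], T, h => by
    simp only [sumG, Option.some.injEq] at h
    subst h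
    exact mem_zero
  | (p, s) :: l, T, h => by
    simp only [sumG] at h
    split at h
    · rename_i G T' hG hT'
      simp only [Option.some.injEq] at h
      subst h
      exact MI.mem_add (mem_sumG hpi hE l hT') (MI.mem_mulInt (mem_legG hpi hE hG) s)
    · simp at h

/-- `realA η legs = angle (26/5) η = D15 η + 2π`. -/
theorem realA_legs (η : ℝ) : realA η legs = D15 η + 2 * Real.pi := by
  rw [D15_eq]
  simp only [realA, legs, numLegs, denAngle]
  push_cast
  ring

/-- `realG η legs + profileConst − 2π|η| = P15 η`. -/
theorem realG_legs (η : ℝ) : realG η legs + profileConst - 2 * Real.pi * |η| = P15 η := by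
  rw [P15_eq]
  simp only [realG, legs]
  push_cast
  ring

/-- Enclosure of `profileConst = 11 log 11 − 13 log 13 − 9 log 9 − 5 log 5 + 16`. -/
def constG : Option MI :=
  match MI.logNat2 sc KL 11, MI.logNat2 sc KL 13, MI.logNat2 sc KL 9, MI.logNat2 sc KL 5 with
  | some A, some B, some C, some D =>
    some (((((A.mulInt 11).sub (B.mulInt 13)).sub (C.mulInt 9)).sub (D.mulInt 5)).add
      (MI.ofInt sc 16))
  | _, _, _, _ => none

/-- Soundness of `constG`. -/
theorem mem_constG {C : MI} (h : constG = some C) : MI.mem sc profileConst C := by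
  unfold constG at h
  split at h
  · rename_i A B C' D hA hB hC hD
    simp only [Option.some.injEq] at h
    subst h
    have key := MI.mem_add (MI.mem_sub (MI.mem_sub (MI.mem_sub
      (MI.mem_mulInt (MI.mem_logNat2 sc_pos hA) 11) (MI.mem_mulInt (MI.mem_logNat2 sc_pos hB) 13))
      (MI.mem_mulInt (MI.mem_logNat2 sc_pos hC) 9)) (MI.mem_mulInt (MI.mem_logNat2 sc_pos hD) 5))
      (MI.mem_ofInt sc 16)
    have e : Real.log ((11 : ℕ) : ℝ) * ((11 : ℤ) : ℝ) - Real.log ((13 : ℕ) : ℝ) * ((13 : ℤ) : ℝ)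
        - Real.log ((9 : ℕ) : ℝ) * ((9 : ℤ) : ℝ) - Real.log ((5 : ℕ) : ℝ) * ((5 : ℤ) : ℝ)
        + ((16 : ℤ) : ℝ) = profileConst := by
      simp only [profileConst]
      push_cast
      ring
    rw [e] at key
    exact key
  · simp at h

/-- `η₁ = 1344/625 = 2.1504`. -/
def etaOne : MI := MI.ofFrac sc 1344 625

/-- `η₂ = 10753/5000 = 2.1506`. -/
def etaTwo : MI := MI.ofFrac sc 10753 5000

/-- The kernel test: `D15 η₁ ≥ 0`, `D15 η₂ ≤ 0`, and
`P15 η₁ + D15 η₁ (η₂ − η₁) ≤ −29.1078708`, as integer inequalities between enclosure ends. -/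
def certCheck : Bool :=
  match MI.pi sc KA with
  | some piI =>
    match sumA piI etaOne legs, sumA piI etaTwo legs, sumG piI etaOne legs, constG with
    | some A1, some A2, some G1, some C =>
      decide (2 * piI.hi ≤ A1.lo) && (decide (A2.hi ≤ 2 * piI.lo) &&
        decide (10 ^ 7 * (5000 * (G1.hi + C.hi) - 21504 * piI.lo + (A1.hi - 2 * piI.lo))
          ≤ -(291078708 * 5000 * (sc : ℤ))))
    | _, _, _, _ => false
  | none => false

/-- The kernel test passes (kernel evaluation of the interval engine). -/
theorem certCheck_eq : certCheck = true := by
  decide +kernel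

/-- Soundness of the kernel test. -/
theorem certCheck_sound (h : certCheck = true) :
    0 ≤ D15 (1344 / 625) ∧ D15 (10753 / 5000) ≤ 0 ∧
      P15 (1344 / 625) + D15 (1344 / 625) * (10753 / 5000 - 1344 / 625) ≤ -29.1078708 := by
  unfold certCheck at h
  split at h
  · rename_i piI hpiI
    split at h
    · rename_i A1 A2 G1 C hA1 hA2 hG1 hC
      simp only [Bool.and_eq_true, decide_eq_true_eq] at h
      obtain ⟨i1, i2, i3⟩ := h
      have hS : (0 : ℝ) < sc := by exact_mod_cast sc_pos
      have hpi := MI.mem_pi sc hpiI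
      have hE1 : MI.mem sc (1344 / 625 : ℝ) etaOne := by
        simpa [etaOne] using MI.mem_ofFrac sc 1344 (by norm_num : 0 < 625)
      have hE2 : MI.mem sc (10753 / 5000 : ℝ) etaTwo := by
        simpa [etaTwo] using MI.mem_ofFrac sc 10753 (by norm_num : 0 < 5000)
      have mA1 := mem_sumA hpi hE1 legs hA1
      have mA2 := mem_sumA hpi hE2 legs hA2
      have mG1 := mem_sumG hpi hE1 legs hG1
      have mC := mem_constG hC
      rw [realA_legs] at mA1 mA2
      have c1 : (2 : ℝ) * piI.hi ≤ A1.lo := by exact_mod_cast i1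
      have c2 : (A2.hi : ℝ) ≤ 2 * piI.lo := by exact_mod_cast i2
      have c3 : (10 : ℝ) ^ 7 * (5000 * ((G1.hi : ℝ) + C.hi) - 21504 * piI.lo
          + (A1.hi - 2 * piI.lo)) ≤ -(291078708 * 5000 * (sc : ℝ)) := by
        exact_mod_cast i3
      have eP := realG_legs (1344 / 625 : ℝ)
      rw [abs_of_pos (by norm_num : (0 : ℝ) < 1344 / 625)] at eP
      unfold MI.mem at hpi mA1 mA2 mG1 mC
      refine ⟨?_, ?_, ?_⟩
      · have key : (2 * Real.pi) * sc ≤ (D15 (1344 / 625) + 2 * Real.pi) * sc := by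
          linarith [hpi.2, mA1.1]
        nlinarith [le_of_mul_le_mul_right key hS]
      · have key : (D15 (10753 / 5000) + 2 * Real.pi) * sc ≤ (2 * Real.pi) * sc := by
          linarith [hpi.1, mA2.2]
        nlinarith [le_of_mul_le_mul_right key hS]
      · rw [← eP]
        have hD : D15 (1344 / 625) * sc ≤ (A1.hi : ℝ) - 2 * piI.lo := by
          have := mA1.2
          linarith [hpi.1]
        have key : (realG (1344 / 625) legs + profileConst - 2 * Real.pi * (1344 / 625)
            + D15 (1344 / 625) * (10753 / 5000 - 1344 / 625)) * sc
            ≤ (-29.1078708 : ℝ) * sc := by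
          nlinarith [mG1.2, mC.2, hpi.1, hD]
        exact le_of_mul_le_mul_right key hS
    · simp at h
  · simp at h

/-- **The certificate**: `profile (26/5) η ≤ −29.1078708` for every `η > 0`. -/
theorem profile_le_of_pos {η : ℝ} (hη : 0 < η) : profile (26 / 5) η ≤ -29.1078708 := by
  obtain ⟨hD1, hD2, hP⟩ := certCheck_sound certCheck_eq
  have h := twoPoint (by norm_num) (by norm_num) (by norm_num) hD1 hD2 hη
  exact h.trans hP

/-- `profile (26/5) η ≤ −29.1078708` for every `η ≠ 0` (evenness). -/
theorem profile_le {η : ℝ} (hη : η ≠ 0) : profile (26 / 5) η ≤ -29.1078708 := by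
  rcases lt_or_gt_of_ne hη with h | h
  · rw [← profile_neg_eta]
    exact profile_le_of_pos (neg_pos.2 h)
  · exact profile_le_of_pos h

end Summit.KontsevichZagierPeriods.Zeta5Search.Denom.TwoTaleP15LineCertificate

end
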